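import Summits.QuantumFields.BalabanUV.Beta.FP.TowerK2bStoreyBridgeTwo
import Summits.QuantumFields.BalabanUV.Beta.FP.TowerK2bDefectBrickDoor

/-!
# `BalabanUV.Beta.FP.TowerK2bDefectDoorGaps` — road «FP», binder row D1, ROUTE T (β1): **THE END WRAPPER's WARD DEFECT IS THE TOWER RECURSION OF DOOR GAPS**
# (road `TowerK2bDefectClosed.def_allDepths`' remainder letter `R` (pins `hR0 ∕ hRsucc`, p625806) welded to an2 PART 37 `TowerK2bDefectBrickDoor.defect_eq_fineDoor_sub_brickDoor`
# (p6261xx) through the window reindexing `τ := Fin 4 × ↥(offs Lc)`): for every torus gauge function `λ`,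
# `Σ_s λ s • R (m+1) ρ′ w s = wM2 • ([E_λ, L̂ᵀ·H·L̂] − L̂ᵀ·[E_rt, H]·L̂) + Σ_{κ, e ∈ offs} ℓ(ρ′,w; κ, Lc•w+e) • Σ_s λ s • R m κ (Lc•w+e) s`  and
# `Σ_s λ s • R 0 ρ′ w s = wM2 • ([E_λ, L̂ᵀ·H·L̂] − L̂ᵀ·[E_rt, H]·L̂)` (depth 2), with the WINDOW-INDEXED letters `L̂ := Matrix.of (legs)` (row `b = (κ,e)` = the composite transport
# `x ↦ Σ'ₙ compLinKer … (x.2, x.1 + M∘n) (κ, Lc•w+e)` of the window bond), `H := Matrix.of (h(ρ′,w; b₁, b₂))` (the antisymmetric Hessian brick), `E_λ := diagonal (λ ∘ Prod.fst)`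
# (the FINE door's generator) and `E_rt := diagonal (λ ∘ roots)` (the BRICK-LEVEL generator: `λ` sampled at the composite roots `ŵ(Lc^(m+2)•(Lc•w+e) + Σ_{k<m+2} Lc^k•ctr)`)
# — i.e. v8∕v9's `Def(λ; β)` at box `n` summed against `λ` is `wM2 •` the DOOR GAP of the top storey («fine door of the transported brick» minus «transported brick-level door»)
# plus the window-weighted door gaps of every storey below: the located content of Q-FP-47-1 as ONE kernel recursion (SPEC-63 §2's target (T2) storey by storey)

WHY (`g49/SPEC-63.md` §2; an2 A-2 l.68356 ∕ INTENT-2 l.68369; road W-2 l.68373 INFO-1).  `def_allDepths` displays `R` by its recursion in an2's WINDOW presentation (`Σ_κ Σ_{e ∈ offs Lc}`);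
`TowerK2bDefectSplit` ∕ PART 36 ∕ PART 37 are stated over a `Fintype` brick index (`∑ b₁, ∑ b₂`).  §0 is the reindexing (`Fintype.sum_prod_type` + `Finset.sum_coe_sort`); §1–§2 instantiate
PART 37 at `pr := Prod.fst`, `τ := Fin (3+1) × ↥(offs Lc)`, the composite legs∕roots∕bricks of `hRsucc` (any depth) and of `hR0` (depth 2).  [folklore] reindexing BY NAME; no `def`,
no `def … : Prop`, nothing cited, 0 sorry.  No claim that any door gap vanishes (by value it does NOT at n = 0: Engine C K2L-C ∕ K2L-SPLIT ∕ K2L-OVL, zero weight); (J-R₂″) NOT claimed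
either way; nothing typed on the order-2 H-side (ROAD POLICY g49); the law's re-posing (door (ii), R-AN2-73-1) is the law owner's.  Nothing of Bałaban's asserted, valued or discharged;
0 estimates; 0∕4 row-D1 binders (hW, hR, D1Tel, D1Rep); ROOT M‴ p325680 ∕ P5c ∕ D6 untouched; NOT (C1), NOT (T-ID), NOT D1, NEVER «G-an2-4 closed», NOT BetaPertH, NOT continuum, NOT Clay.

HONEST DEPENDENCY (page 1, mandatory): continuum YM on T⁴ ⇐ BetaPertH ∧ nine spine estimates (0/9 proved); BetaPertH ⇐ (D1) ∧ (D4) ∧ CAP+tail;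
G-an2-4 gates asym, D1 and NE2/3/4.  HONEST FRAMING (cell contract, verbatim): «discharging `BetaPertH` makes Bałaban's UV stability UNCONDITIONAL —
a real constructive-QFT result; it is NOT the continuum limit and NOT the Clay problem.»  ABSOLUTE RULE (cell charter, verbatim): «No internally-minted
statement may enter as a cited fact. Every hypothesis is either kernel-proved in this package or a verbatim quotation of a PUBLISHED theorem with page
reference. The manuscript(s) under audit are NOT citable for their own disputed steps — they are the thing under adjudication; programme-internal
(2001/route/tribunal) claims are never citable.»  Road «FP» OWNER, b2b-balaban-beta-d1-p3 gen 49, 2026-08-28.  No existing file touched.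
-/

noncomputable section

open scoped BigOperators

namespace Summit.QuantumFields.BalabanUV.Beta.FP.TowerK2bDefectDoorGaps

open Finset Matrix
open Literature.MathematicalPhysics.QuantumFieldTheory
open Literature.MathematicalPhysics.QuantumFieldTheory.Balaban1983to89
open Literature.MathematicalPhysics.QuantumFieldTheory.Balaban1983to89.Beta
open B4TorusKernel.MultiPeriod (translate)
open B6Lemma24Torus (pbox)
open AffineAveraging (Site)
open AveragingContoursRooted (ctr)
open BalabanStepW2 (wM2)
open Summit.QuantumFields.BalabanUV.Beta.SymAveragingHessianCounts (symLinKerAt symHessKerAt)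
open Summit.QuantumFields.BalabanUV.Beta.CompositeVertexKernelRec (offs compLinKer)
open Summit.QuantumFields.BalabanUV.Beta.FP.TorusGaugeCovariancePairing (wrapPt)
open Summit.QuantumFields.BalabanUV.Beta.FP.TowerK2bDefectBrickDoor (defect_eq_fineDoor_sub_brickDoor topDefect_eq_smul_doorGap)

variable {Lc : ℕ}

/-! ## §0 The window reindexing: an2's `Σ_κ Σ_{e ∈ offs Lc}` as ONE `Fintype` sum over `Fin 4 × ↥(offs Lc)` -/

/-- [folklore] `Σ_κ Σ_{e ∈ offs Lc} G κ e = Σ_{b : Fin 4 × ↥(offs Lc)} G b.1 ↑b.2`. -/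
theorem sum_offs_eq_sum_coe {α : Type*} [AddCommMonoid α] (G : Fin (3 + 1) → Site (3 + 1) → α) :
    ∑ κ : Fin (3 + 1), ∑ e ∈ offs Lc, G κ e = ∑ b : Fin (3 + 1) × ↥(offs (d := 3) Lc), G b.1 (b.2 : Site (3 + 1)) := by
  rw [Fintype.sum_prod_type]
  exact Finset.sum_congr rfl fun κ _ => (Finset.sum_coe_sort (offs Lc) (G κ)).symm

section DoorGaps

variable {M : Fin (3 + 1) → ℕ} [∀ μ, NeZero (M μ)] (L₂ j : ℕ)

/-- [folklore] **`sum_smul_R_succ_eq_doorGap` — ONE STOREY OF THE END's WARD DEFECT IS A DOOR GAP** (`def_allDepths`' pin `hRsucc` through PART 37): for every `m`,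
coarse bond `(ρ′, w)` and torus gauge function `λ`, `Σ_s λ s • R (m+1) ρ′ w s = wM2 • ([E_λ, L̂ᵀHL̂] − L̂ᵀ[E_rt, H]L̂) + Σ_{κ, e} ℓ(ρ′,w; κ, Lc•w+e) • Σ_s λ s • R m κ (Lc•w+e) s`
with the window-indexed leg matrix `L̂` (composite legs `compLinKer (m+2)`), brick `H`, fine generator `E_λ = diagonal (λ ∘ fst)` and brick-level generator `E_rt` (λ at the
composite roots `ŵ(Lc^(m+2)•(Lc•w+e) + Σ_{k<m+2} Lc^k•ctr)`). -/
theorem sum_smul_R_succ_eq_doorGap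
    (R : ℕ → Fin (3 + 1) → Site (3 + 1) → ↥(pbox M) → Matrix (↥(pbox M) × Fin (3 + 1)) (↥(pbox M) × Fin (3 + 1)) ℝ)
    (hRsucc : ∀ (m : ℕ) (ρ' : Fin (3 + 1)) (w : Site (3 + 1)) (s : ↥(pbox M)), R (m + 1) ρ' w s
      = wM2 3 L₂ j • (∑ κ₁ : Fin (3 + 1), ∑ e₁ ∈ offs Lc, ∑ κ₂ : Fin (3 + 1), ∑ e₂ ∈ offs Lc,
            symHessKerAt (ctr 4 Lc) Lc ρ' w (κ₁, (Lc : ℤ) • w + e₁) (κ₂, (Lc : ℤ) • w + e₂) •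
              (Matrix.vecMulVec
                  (fun x : ↥(pbox M) × Fin (3 + 1) => ((if x.1 = s then (1 : ℝ) else 0)
                      - (if wrapPt M (((Lc ^ (m + 1 + 1) : ℕ) : ℤ) • ((Lc : ℤ) • w + e₁) + ∑ k ∈ Finset.range (m + 1 + 1), ((Lc ^ k : ℕ) : ℤ) • ctr 4 Lc) = s then (1 : ℝ) else 0))
                    * ∑' n : Site (3 + 1), compLinKer (fun _ => symLinKerAt (ctr 4 Lc) Lc) Lc (m + 1 + 1) (x.2, translate M (x.1 : Site (3 + 1)) n) (κ₁, (Lc : ℤ) • w + e₁))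
                  (fun z : ↥(pbox M) × Fin (3 + 1) => ∑' n : Site (3 + 1),
                    compLinKer (fun _ => symLinKerAt (ctr 4 Lc) Lc) Lc (m + 1 + 1) (z.2, translate M (z.1 : Site (3 + 1)) n) (κ₂, (Lc : ℤ) • w + e₂))
                - Matrix.vecMulVec
                  (fun x : ↥(pbox M) × Fin (3 + 1) => ∑' n : Site (3 + 1),
                    compLinKer (fun _ => symLinKerAt (ctr 4 Lc) Lc) Lc (m + 1 + 1) (x.2, translate M (x.1 : Site (3 + 1)) n) (κ₁, (Lc : ℤ) • w + e₁))
                  (fun z : ↥(pbox M) × Fin (3 + 1) => ((if z.1 = s then (1 : ℝ) else 0)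
                      - (if wrapPt M (((Lc ^ (m + 1 + 1) : ℕ) : ℤ) • ((Lc : ℤ) • w + e₂) + ∑ k ∈ Finset.range (m + 1 + 1), ((Lc ^ k : ℕ) : ℤ) • ctr 4 Lc) = s then (1 : ℝ) else 0))
                    * ∑' n : Site (3 + 1), compLinKer (fun _ => symLinKerAt (ctr 4 Lc) Lc) Lc (m + 1 + 1) (z.2, translate M (z.1 : Site (3 + 1)) n) (κ₂, (Lc : ℤ) • w + e₂))))
        + ∑ κ : Fin (3 + 1), ∑ e ∈ offs Lc, symLinKerAt (ctr 4 Lc) Lc ρ' w (κ, (Lc : ℤ) • w + e) • R m κ ((Lc : ℤ) • w + e) s)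
    (m : ℕ) (ρ' : Fin (3 + 1)) (w : Site (3 + 1)) (lam : ↥(pbox M) → ℝ) :
    ∑ s : ↥(pbox M), lam s • R (m + 1) ρ' w s
      = wM2 3 L₂ j • (Matrix.diagonal (fun x : ↥(pbox M) × Fin (3 + 1) => lam x.1)
              * ((Matrix.of fun (b : Fin (3 + 1) × ↥(offs (d := 3) Lc)) (x : ↥(pbox M) × Fin (3 + 1)) => ∑' n : Site (3 + 1),
                    compLinKer (fun _ => symLinKerAt (ctr 4 Lc) Lc) Lc (m + 1 + 1) (x.2, translate M (x.1 : Site (3 + 1)) n) (b.1, (Lc : ℤ) • w + (b.2 : Site (3 + 1))))ᵀ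
                * Matrix.of (fun b₁ b₂ : Fin (3 + 1) × ↥(offs (d := 3) Lc) =>
                    symHessKerAt (ctr 4 Lc) Lc ρ' w (b₁.1, (Lc : ℤ) • w + (b₁.2 : Site (3 + 1))) (b₂.1, (Lc : ℤ) • w + (b₂.2 : Site (3 + 1))))
                * Matrix.of fun (b : Fin (3 + 1) × ↥(offs (d := 3) Lc)) (x : ↥(pbox M) × Fin (3 + 1)) => ∑' n : Site (3 + 1),
                    compLinKer (fun _ => symLinKerAt (ctr 4 Lc) Lc) Lc (m + 1 + 1) (x.2, translate M (x.1 : Site (3 + 1)) n) (b.1, (Lc : ℤ) • w + (b.2 : Site (3 + 1))))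
            - ((Matrix.of fun (b : Fin (3 + 1) × ↥(offs (d := 3) Lc)) (x : ↥(pbox M) × Fin (3 + 1)) => ∑' n : Site (3 + 1),
                    compLinKer (fun _ => symLinKerAt (ctr 4 Lc) Lc) Lc (m + 1 + 1) (x.2, translate M (x.1 : Site (3 + 1)) n) (b.1, (Lc : ℤ) • w + (b.2 : Site (3 + 1))))ᵀ
                * Matrix.of (fun b₁ b₂ : Fin (3 + 1) × ↥(offs (d := 3) Lc) =>
                    symHessKerAt (ctr 4 Lc) Lc ρ' w (b₁.1, (Lc : ℤ) • w + (b₁.2 : Site (3 + 1))) (b₂.1, (Lc : ℤ) • w + (b₂.2 : Site (3 + 1))))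
                * Matrix.of fun (b : Fin (3 + 1) × ↥(offs (d := 3) Lc)) (x : ↥(pbox M) × Fin (3 + 1)) => ∑' n : Site (3 + 1),
                    compLinKer (fun _ => symLinKerAt (ctr 4 Lc) Lc) Lc (m + 1 + 1) (x.2, translate M (x.1 : Site (3 + 1)) n) (b.1, (Lc : ℤ) • w + (b.2 : Site (3 + 1))))
              * Matrix.diagonal (fun x : ↥(pbox M) × Fin (3 + 1) => lam x.1))
        - wM2 3 L₂ j • ((Matrix.of fun (b : Fin (3 + 1) × ↥(offs (d := 3) Lc)) (x : ↥(pbox M) × Fin (3 + 1)) => ∑' n : Site (3 + 1),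
                    compLinKer (fun _ => symLinKerAt (ctr 4 Lc) Lc) Lc (m + 1 + 1) (x.2, translate M (x.1 : Site (3 + 1)) n) (b.1, (Lc : ℤ) • w + (b.2 : Site (3 + 1))))ᵀ
            * (Matrix.diagonal (fun b : Fin (3 + 1) × ↥(offs (d := 3) Lc) =>
                  lam (wrapPt M (((Lc ^ (m + 1 + 1) : ℕ) : ℤ) • ((Lc : ℤ) • w + (b.2 : Site (3 + 1))) + ∑ k ∈ Finset.range (m + 1 + 1), ((Lc ^ k : ℕ) : ℤ) • ctr 4 Lc)))
                * Matrix.of (fun b₁ b₂ : Fin (3 + 1) × ↥(offs (d := 3) Lc) =>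
                    symHessKerAt (ctr 4 Lc) Lc ρ' w (b₁.1, (Lc : ℤ) • w + (b₁.2 : Site (3 + 1))) (b₂.1, (Lc : ℤ) • w + (b₂.2 : Site (3 + 1))))
              - Matrix.of (fun b₁ b₂ : Fin (3 + 1) × ↥(offs (d := 3) Lc) =>
                    symHessKerAt (ctr 4 Lc) Lc ρ' w (b₁.1, (Lc : ℤ) • w + (b₁.2 : Site (3 + 1))) (b₂.1, (Lc : ℤ) • w + (b₂.2 : Site (3 + 1))))
                * Matrix.diagonal (fun b : Fin (3 + 1) × ↥(offs (d := 3) Lc) =>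
                  lam (wrapPt M (((Lc ^ (m + 1 + 1) : ℕ) : ℤ) • ((Lc : ℤ) • w + (b.2 : Site (3 + 1))) + ∑ k ∈ Finset.range (m + 1 + 1), ((Lc ^ k : ℕ) : ℤ) • ctr 4 Lc))))
            * Matrix.of fun (b : Fin (3 + 1) × ↥(offs (d := 3) Lc)) (x : ↥(pbox M) × Fin (3 + 1)) => ∑' n : Site (3 + 1),
                    compLinKer (fun _ => symLinKerAt (ctr 4 Lc) Lc) Lc (m + 1 + 1) (x.2, translate M (x.1 : Site (3 + 1)) n) (b.1, (Lc : ℤ) • w + (b.2 : Site (3 + 1))))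
        + ∑ κ : Fin (3 + 1), ∑ e ∈ offs Lc, symLinKerAt (ctr 4 Lc) Lc ρ' w (κ, (Lc : ℤ) • w + e) • ∑ s : ↥(pbox M), lam s • R m κ ((Lc : ℤ) • w + e) s := by
  have key := defect_eq_fineDoor_sub_brickDoor (ι := ↥(pbox M) × Fin (3 + 1)) (σ := ↥(pbox M)) (τ := Fin (3 + 1) × ↥(offs (d := 3) Lc))
    Prod.fst lam
    (fun b₁ b₂ => symHessKerAt (ctr 4 Lc) Lc ρ' w (b₁.1, (Lc : ℤ) • w + (b₁.2 : Site (3 + 1))) (b₂.1, (Lc : ℤ) • w + (b₂.2 : Site (3 + 1))))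
    (fun b x => ∑' n : Site (3 + 1), compLinKer (fun _ => symLinKerAt (ctr 4 Lc) Lc) Lc (m + 1 + 1) (x.2, translate M (x.1 : Site (3 + 1)) n) (b.1, (Lc : ℤ) • w + (b.2 : Site (3 + 1))))
    (fun b => wrapPt M (((Lc ^ (m + 1 + 1) : ℕ) : ℤ) • ((Lc : ℤ) • w + (b.2 : Site (3 + 1))) + ∑ k ∈ Finset.range (m + 1 + 1), ((Lc ^ k : ℕ) : ℤ) • ctr 4 Lc))
    (fun b => symLinKerAt (ctr 4 Lc) Lc ρ' w (b.1, (Lc : ℤ) • w + (b.2 : Site (3 + 1))))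
    (fun s b => R m b.1 ((Lc : ℤ) • w + (b.2 : Site (3 + 1))) s) (wM2 3 L₂ j)
  simp only [hRsucc, sum_offs_eq_sum_coe]
  exact key

/-- [folklore] **`sum_smul_R_zero_eq_doorGap` — THE DEPTH-2 WORD IS A DOOR GAP** (`def_allDepths`' pin `hR0` = `def_depthTwo`'s word, through PART 37's
`topDefect_eq_smul_doorGap`): `Σ_s λ s • R 0 ρ′ w s = wM2 • ([E_λ, L̂ᵀHL̂] − L̂ᵀ[E_rt, H]L̂)` with the one-step legs `x ↦ Σ'ₙ symLinKerAt ctr Lc κ (Lc•w+e) (x.2, x.1 + M∘n)`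
and the level-1 roots `ŵ(Lc•(Lc•w+e) + ctr)` — no lower storeys. -/
theorem sum_smul_R_zero_eq_doorGap
    (R : ℕ → Fin (3 + 1) → Site (3 + 1) → ↥(pbox M) → Matrix (↥(pbox M) × Fin (3 + 1)) (↥(pbox M) × Fin (3 + 1)) ℝ)
    (hR0 : ∀ (ρ' : Fin (3 + 1)) (w : Site (3 + 1)) (s : ↥(pbox M)), R 0 ρ' w s
      = wM2 3 L₂ j • ∑ κ₁ : Fin (3 + 1), ∑ e₁ ∈ offs Lc, ∑ κ₂ : Fin (3 + 1), ∑ e₂ ∈ offs Lc,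
            symHessKerAt (ctr 4 Lc) Lc ρ' w (κ₁, (Lc : ℤ) • w + e₁) (κ₂, (Lc : ℤ) • w + e₂) •
              (Matrix.vecMulVec
                  (fun x : ↥(pbox M) × Fin (3 + 1) => ((if x.1 = s then (1 : ℝ) else 0) - (if wrapPt M ((Lc : ℤ) • ((Lc : ℤ) • w + e₁) + ctr 4 Lc) = s then (1 : ℝ) else 0))
                    * ∑' n : Site (3 + 1), symLinKerAt (ctr 4 Lc) Lc κ₁ ((Lc : ℤ) • w + e₁) (x.2, translate M (x.1 : Site (3 + 1)) n))
                  (fun z : ↥(pbox M) × Fin (3 + 1) => ∑' n : Site (3 + 1), symLinKerAt (ctr 4 Lc) Lc κ₂ ((Lc : ℤ) • w + e₂) (z.2, translate M (z.1 : Site (3 + 1)) n))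
                - Matrix.vecMulVec
                  (fun x : ↥(pbox M) × Fin (3 + 1) => ∑' n : Site (3 + 1), symLinKerAt (ctr 4 Lc) Lc κ₁ ((Lc : ℤ) • w + e₁) (x.2, translate M (x.1 : Site (3 + 1)) n))
                  (fun z : ↥(pbox M) × Fin (3 + 1) => ((if z.1 = s then (1 : ℝ) else 0) - (if wrapPt M ((Lc : ℤ) • ((Lc : ℤ) • w + e₂) + ctr 4 Lc) = s then (1 : ℝ) else 0))
                    * ∑' n : Site (3 + 1), symLinKerAt (ctr 4 Lc) Lc κ₂ ((Lc : ℤ) • w + e₂) (z.2, translate M (z.1 : Site (3 + 1)) n))))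
    (ρ' : Fin (3 + 1)) (w : Site (3 + 1)) (lam : ↥(pbox M) → ℝ) :
    ∑ s : ↥(pbox M), lam s • R 0 ρ' w s
      = wM2 3 L₂ j • (Matrix.diagonal (fun x : ↥(pbox M) × Fin (3 + 1) => lam x.1)
              * ((Matrix.of fun (b : Fin (3 + 1) × ↥(offs (d := 3) Lc)) (x : ↥(pbox M) × Fin (3 + 1)) => ∑' n : Site (3 + 1),
                    symLinKerAt (ctr 4 Lc) Lc b.1 ((Lc : ℤ) • w + (b.2 : Site (3 + 1))) (x.2, translate M (x.1 : Site (3 + 1)) n))ᵀ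
                * Matrix.of (fun b₁ b₂ : Fin (3 + 1) × ↥(offs (d := 3) Lc) =>
                    symHessKerAt (ctr 4 Lc) Lc ρ' w (b₁.1, (Lc : ℤ) • w + (b₁.2 : Site (3 + 1))) (b₂.1, (Lc : ℤ) • w + (b₂.2 : Site (3 + 1))))
                * Matrix.of fun (b : Fin (3 + 1) × ↥(offs (d := 3) Lc)) (x : ↥(pbox M) × Fin (3 + 1)) => ∑' n : Site (3 + 1),
                    symLinKerAt (ctr 4 Lc) Lc b.1 ((Lc : ℤ) • w + (b.2 : Site (3 + 1))) (x.2, translate M (x.1 : Site (3 + 1)) n))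
            - ((Matrix.of fun (b : Fin (3 + 1) × ↥(offs (d := 3) Lc)) (x : ↥(pbox M) × Fin (3 + 1)) => ∑' n : Site (3 + 1),
                    symLinKerAt (ctr 4 Lc) Lc b.1 ((Lc : ℤ) • w + (b.2 : Site (3 + 1))) (x.2, translate M (x.1 : Site (3 + 1)) n))ᵀ
                * Matrix.of (fun b₁ b₂ : Fin (3 + 1) × ↥(offs (d := 3) Lc) =>
                    symHessKerAt (ctr 4 Lc) Lc ρ' w (b₁.1, (Lc : ℤ) • w + (b₁.2 : Site (3 + 1))) (b₂.1, (Lc : ℤ) • w + (b₂.2 : Site (3 + 1))))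
                * Matrix.of fun (b : Fin (3 + 1) × ↥(offs (d := 3) Lc)) (x : ↥(pbox M) × Fin (3 + 1)) => ∑' n : Site (3 + 1),
                    symLinKerAt (ctr 4 Lc) Lc b.1 ((Lc : ℤ) • w + (b.2 : Site (3 + 1))) (x.2, translate M (x.1 : Site (3 + 1)) n))
              * Matrix.diagonal (fun x : ↥(pbox M) × Fin (3 + 1) => lam x.1)
          - (Matrix.of fun (b : Fin (3 + 1) × ↥(offs (d := 3) Lc)) (x : ↥(pbox M) × Fin (3 + 1)) => ∑' n : Site (3 + 1),
                    symLinKerAt (ctr 4 Lc) Lc b.1 ((Lc : ℤ) • w + (b.2 : Site (3 + 1))) (x.2, translate M (x.1 : Site (3 + 1)) n))ᵀ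
            * (Matrix.diagonal (fun b : Fin (3 + 1) × ↥(offs (d := 3) Lc) => lam (wrapPt M ((Lc : ℤ) • ((Lc : ℤ) • w + (b.2 : Site (3 + 1))) + ctr 4 Lc)))
                * Matrix.of (fun b₁ b₂ : Fin (3 + 1) × ↥(offs (d := 3) Lc) =>
                    symHessKerAt (ctr 4 Lc) Lc ρ' w (b₁.1, (Lc : ℤ) • w + (b₁.2 : Site (3 + 1))) (b₂.1, (Lc : ℤ) • w + (b₂.2 : Site (3 + 1))))
              - Matrix.of (fun b₁ b₂ : Fin (3 + 1) × ↥(offs (d := 3) Lc) =>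
                    symHessKerAt (ctr 4 Lc) Lc ρ' w (b₁.1, (Lc : ℤ) • w + (b₁.2 : Site (3 + 1))) (b₂.1, (Lc : ℤ) • w + (b₂.2 : Site (3 + 1))))
                * Matrix.diagonal (fun b : Fin (3 + 1) × ↥(offs (d := 3) Lc) => lam (wrapPt M ((Lc : ℤ) • ((Lc : ℤ) • w + (b.2 : Site (3 + 1))) + ctr 4 Lc))))
            * Matrix.of fun (b : Fin (3 + 1) × ↥(offs (d := 3) Lc)) (x : ↥(pbox M) × Fin (3 + 1)) => ∑' n : Site (3 + 1),
                    symLinKerAt (ctr 4 Lc) Lc b.1 ((Lc : ℤ) • w + (b.2 : Site (3 + 1))) (x.2, translate M (x.1 : Site (3 + 1)) n)) := by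
  have key := topDefect_eq_smul_doorGap (ι := ↥(pbox M) × Fin (3 + 1)) (σ := ↥(pbox M)) (τ := Fin (3 + 1) × ↥(offs (d := 3) Lc))
    Prod.fst lam
    (fun b₁ b₂ => symHessKerAt (ctr 4 Lc) Lc ρ' w (b₁.1, (Lc : ℤ) • w + (b₁.2 : Site (3 + 1))) (b₂.1, (Lc : ℤ) • w + (b₂.2 : Site (3 + 1))))
    (fun b x => ∑' n : Site (3 + 1), symLinKerAt (ctr 4 Lc) Lc b.1 ((Lc : ℤ) • w + (b.2 : Site (3 + 1))) (x.2, translate M (x.1 : Site (3 + 1)) n))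
    (fun b => wrapPt M ((Lc : ℤ) • ((Lc : ℤ) • w + (b.2 : Site (3 + 1))) + ctr 4 Lc)) (wM2 3 L₂ j)
  simp only [hR0, sum_offs_eq_sum_coe]
  exact key

end DoorGaps

end Summit.QuantumFields.BalabanUV.Beta.FP.TowerK2bDefectDoorGaps

end
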